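import Summits.BirchSwinnertonDyer.Rank1Residual.Additive.KummerDeuringModel
import Summits.BirchSwinnertonDyer.Rank1Residual.Additive.SubGordHigherOrdinary
import Mathlib.AlgebraicGeometry.EllipticCurve.NormalForms
import HarnessLib

/-!
# The Kummer–Deuring good model with a GLOBAL Kummer generator `θ ∈ ℚ̄`, `θ^e = p`: the model is
# FIXED BY EVERY `σ ∈ Γ_{ℚ_v}` FIXING `ι θ` (the interface of p05's R-D identification on the
# `e ∈ {3,4,6}` rows, T-RD-E346 piece 3)
# (cell `b2b-bsdres`, team n1011, seat p07 (gen 7); row T-ROL-EXP FILE A3, sequel of A2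
# `KummerDeuringModel`; asked by p05 GEN 6, HOME/INBOX.md 2026-08-21T16:24Z)

HONEST FRAMING (cell `b2b-bsdres`, run/shared/lean/b2b/bsd-rank1-residual/, verbatim in every
file): the goal of the cell is to DELETE the COMBINATION-SHAPED residual classes of the
Birch–Swinnerton-Dyer formula for ALL analytic-rank `≤ 1` elliptic curves over `ℚ` — "full BSD
formula for every rank `≤ 1` curve in class `C`" assembled STRICTLY from published theorems — so
that the rank-`≤ 1` remainder becomes exactly the CONSTRUCTION-SHAPED classes, which are TYPED
(missing-input `Prop`s), NOT attempted. This is not "finishing BSD". Team n1011 (N10/N11): research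
route on the CONSTRUCTION-SHAPED classes X3♯(G-ord)/X4♯(G-ord); prove what is provable now; no
claim beyond stated classes; census output = EVIDENCE, never a Literature fact; RESIDUAL-MAP marks
UNCHANGED; nothing is booked by this file. TOOL theorems only: NO definition, NO named fact.

## What and why

FILE A2's `exists_kummerGoodModel` chooses the Kummer element `u` (`u^e = p^m`) LOCALLY in `K̄_v`
and records only that `σ^e` fixes the model for inertial `σ`. p05's R-D identification on the
`e ∈ {3,4,6}` rows (cc-typer-2's S2 record `imKummer_ge_strictCondition_goodOrdinaryModel`, binder
`hHC : res σ ∈ H → C.map σ = C` for a subgroup `H ≤ Γ_ℚ`) wants the fixing group GLOBAL: the model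
must be fixed by every `σ` fixing a GLOBAL generator. This file re-runs A2's construction for ANY
Kummer element (`exists_goodModel_of_kummerElement`: `C = ⟨u,0,0,0⟩ · (short form over ℚ)`, so
`ψ(u) = u ⟹ C.map ψ = C` for EVERY `ℚ_v`-automorphism `ψ` of `K̄_v`) and takes
`u = ι(θ)^m` for a global `θ ∈ ℚ̄` with `θ^e = p`, `ι = absClosureEmbedding ℚ ℚ_v`
(**`exists_kummerGoodModel_global`**): the model is fixed by every `σ ∈ Γ_{ℚ_v}` with
`σ • ι θ = ι θ`, and (Kummer, FILE A1) by `σ^e` for every inertial `σ`.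

References: J. H. Silverman, *AEC* VII.5.5 [SilvermanAEC2009]; J.-P. Serre, Invent. Math. 15 (1972)
§5.6 [Serre1972]; R. Greenberg, LNM 1716 (1999) §2 Prop. 2.4 [GreenbergLNM1716];
cells/n1011/skel/T-ROL-EXP.md (67779f27699eb635), cells/n1011/skel/T-RD-E346.md (f88cc66b311ca16d).
-/

set_option autoImplicit false

noncomputable section

open scoped Classical NNReal NumberField

open WeierstrassCurve

universe u

namespace Summit.BirchSwinnertonDyer.Rank1Residual.Additive.GoodModelLine

open NumberField IsDedekindDomain Field IsDedekindDomain.HeightOneSpectrum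
  Literature.NumberTheory.GaloisRepresentations Literature.NumberTheory.EllipticCurves
  Literature.NumberTheory.EllipticCurves.GreenbergSelmer
  Literature.NumberTheory.EllipticCurves.Rank1Residual
  Summit.BirchSwinnertonDyer.Rank1Residual.X2.GreenbergVatsalReductionDatum

section Local

variable (p : ℕ) [hp : Fact p.Prime] {v : HeightOneSpectrum (𝓞 ℚ)}
  (W : WeierstrassCurve ℚ) [W.IsElliptic] [W.IsGloballyMinimal]

/-! ## §1 The explicit model for ANY Kummer element `u`, `u^e = p^m`, fixed by every `ψ` fixing `u` -/

/-- **The Kummer–Deuring model for a GIVEN Kummer element.** `E/ℚ` globally minimal, `p ≥ 5`,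
`v ∋ p`, `ord_p j(E) ≥ 0`; `u ∈ K̄_v` with `u^e = p^m` (`e = semistabilityIndex W p`,
`m = ord_pΔ_min / gcd(12, ord_pΔ_min)`). Then `C := ⟨u, 0, 0, 0⟩ · (E.toShortNF mapped to K̄_v)`
transforms `E ⊗ K̄_v` into a model `W₀` over `𝒪_w` with UNIT discriminant, and EVERY
`ℚ_v`-automorphism `ψ` of `K̄_v` with `ψ(u) = u` fixes `C` (the short-form change has rational
entries). FILE A2's computation (Silverman *AEC* VII.5.5) with `u` as a parameter.
[cite: SilvermanAEC2009, Prop. VII.5.5] [cite: Serre1972, §5.6 (p. 312)] -/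
theorem exists_goodModel_of_kummerElement (hp5 : 5 ≤ p) (hpv : ((p : ℕ) : 𝓞 ℚ) ∈ v.asIdeal)
    (hj : 0 ≤ padicValRat p W.j) {u : AlgebraicClosure (v.adicCompletion ℚ)}
    (hu : u ^ semistabilityIndex W p = ((p : ℕ) : AlgebraicClosure (v.adicCompletion ℚ)) ^
      (padicValInt p W.minimalDiscriminantInt / Nat.gcd 12 (padicValInt p W.minimalDiscriminantInt))) :
    ∃ (C : VariableChange (AlgebraicClosure (v.adicCompletion ℚ)))
      (W₀ : WeierstrassCurve (specVal v).integer),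
      C • (W.baseChange (v.adicCompletion ℚ)).baseChange (AlgebraicClosure (v.adicCompletion ℚ)) =
        W₀.baseChange (AlgebraicClosure (v.adicCompletion ℚ)) ∧ IsUnit W₀.Δ ∧
      (∃ (hu0 : u ≠ 0) (Cs : VariableChange ℚ),
        C = ⟨Units.mk0 u hu0, 0, 0, 0⟩ *
          Cs.map (algebraMap ℚ (AlgebraicClosure (v.adicCompletion ℚ)))) ∧
      ∀ ψ : AlgebraicClosure (v.adicCompletion ℚ) ≃ₐ[v.adicCompletion ℚ]
          AlgebraicClosure (v.adicCompletion ℚ), ψ u = u →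
        C.map (ψ : AlgebraicClosure (v.adicCompletion ℚ) →+* AlgebraicClosure (v.adicCompletion ℚ)) = C := by
  let L := AlgebraicClosure (v.adicCompletion ℚ)
  set w := specVal v with hw
  set φ : ℚ →+* L := algebraMap ℚ L with hφ
  haveI : CharZero L := charZero_of_injective_algebraMap (algebraMap ℚ L).injective
  have hvO : w.Integers w.integer := Valuation.integer.integers _
  -- the exponent data
  set n : ℕ := padicValInt p W.minimalDiscriminantInt with hn
  set g : ℕ := Nat.gcd 12 n with hg
  set e : ℕ := semistabilityIndex W p with hedef
  set m : ℕ := n / g with hm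
  have heg : e * g = 12 := semistabilityIndex_mul_gcd p W
  have hmg : m * g = n := Nat.div_mul_cancel (Nat.gcd_dvd_right _ _)
  have he0 : e ≠ 0 := semistabilityIndex_ne_zero p W
  have hpe : ¬ p ∣ e := not_dvd_semistabilityIndex p W hp5
  -- the Kummer element `u`, `u ^ e = p ^ m`
  have hp0 : (p : L) ≠ 0 := Nat.cast_ne_zero.mpr hp.out.ne_zero
  have hu' : u ^ e = (p : L) ^ m := hu
  have hu0 : u ≠ 0 := by
    intro h; rw [h, zero_pow he0] at hu'; exact pow_ne_zero m hp0 hu'.symm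
  -- valuations
  set q : ℝ≥0 := w (p : L) with hq
  have hwu : w u ^ e = q ^ m := by rw [← map_pow, hu', map_pow]
  have hwu12 : w u ^ 12 = w (φ W.Δ) := by
    rw [hφ, specVal_Δ_eq_pow p W hpv, ← hn, ← hw, ← hq, ← heg, pow_mul, hwu, ← pow_mul, hmg]
  have hwu0 : w u ≠ 0 := (Valuation.ne_zero_iff _).mpr hu0
  have hc4 : w (φ W.c₄) ≤ w u ^ 4 := by
    have h := specVal_c₄_pow_three_le p W hpv hj
    rw [← hφ, ← hw, ← hwu12, show w u ^ 12 = (w u ^ 4) ^ 3 by ring] at h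
    exact le_of_pow_le_pow_left₀ three_ne_zero (by positivity) h
  have hc6 : w (φ W.c₆) ≤ w u ^ 6 := by
    have h := specVal_c₆_sq_le p W hpv hj
    rw [← hφ, ← hw, ← hwu12, show w u ^ 12 = (w u ^ 6) ^ 2 by ring] at h
    exact le_of_pow_le_pow_left₀ two_ne_zero (by positivity) h
  -- units `48`, `864` at `v` (`p ≥ 5`)
  have h2 : ¬ (p : ℤ) ∣ 2 := by
    intro h
    have := Int.le_of_dvd (by norm_num) h
    have : (p : ℤ) ≥ 5 := by exact_mod_cast hp5
    omega
  have h3 : ¬ (p : ℤ) ∣ 3 := by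
    intro h
    have := Int.le_of_dvd (by norm_num) h
    have : (p : ℤ) ≥ 5 := by exact_mod_cast hp5
    omega
  have hpZ : Prime (p : ℤ) := Nat.prime_iff_prime_int.mp hp.out
  have h48 : w (48 : L) = 1 := by
    have h : ¬ (p : ℤ) ∣ 48 := by
      intro hd
      rw [show (48 : ℤ) = 2 ^ 4 * 3 by norm_num] at hd
      rcases hpZ.dvd_or_dvd hd with hd | hd
      · exact h2 (hpZ.dvd_of_dvd_pow hd)
      · exact h3 hd
    have := spectralValuation_intCast_eq_one_of_natCast_mem hpv (specVal_spec v) (n := 48) h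
    exact_mod_cast this
  have h864 : w (864 : L) = 1 := by
    have h : ¬ (p : ℤ) ∣ 864 := by
      intro hd
      rw [show (864 : ℤ) = 2 ^ 5 * 3 ^ 3 by norm_num] at hd
      rcases hpZ.dvd_or_dvd hd with hd | hd
      · exact h2 (hpZ.dvd_of_dvd_pow hd)
      · exact h3 (hpZ.dvd_of_dvd_pow hd)
    have := spectralValuation_intCast_eq_one_of_natCast_mem hpv (specVal_spec v) (n := 864) h
    exact_mod_cast this
  -- the short normal form over `ℚ`
  haveI : Invertible (2 : ℚ) := invertibleOfNonzero two_ne_zero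
  haveI : Invertible (3 : ℚ) := invertibleOfNonzero three_ne_zero
  set Cs : VariableChange ℚ := W.toShortNF with hCs
  haveI hNF : (Cs • W).IsShortNF := W.toShortNF_spec
  have hCsu : Cs.u = 1 := by
    rw [hCs, WeierstrassCurve.toShortNF, VariableChange.mul_def]
    simp [WeierstrassCurve.toCharNeTwoNF]
  have hs_a₁ : (Cs • W).a₁ = 0 := a₁_of_isShortNF _
  have hs_a₂ : (Cs • W).a₂ = 0 := a₂_of_isShortNF _
  have hs_a₃ : (Cs • W).a₃ = 0 := a₃_of_isShortNF _
  have hs_c₄ : (Cs • W).c₄ = W.c₄ := by rw [variableChange_c₄, hCsu]; simp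
  have hs_c₆ : (Cs • W).c₆ = W.c₆ := by rw [variableChange_c₆, hCsu]; simp
  have hs_Δ : (Cs • W).Δ = W.Δ := by rw [variableChange_Δ, hCsu]; simp
  have ha₄ : (Cs • W).a₄ = -W.c₄ / 48 := by
    have h := c₄_of_isShortNF (Cs • W)
    rw [hs_c₄] at h
    field_simp
    linarith
  have ha₆ : (Cs • W).a₆ = -W.c₆ / 864 := by
    have h := c₆_of_isShortNF (Cs • W)
    rw [hs_c₆] at h
    field_simp
    linarith
  -- integrality of the scaled coefficients
  have hwsa₄ : w (φ (Cs • W).a₄) = w (φ W.c₄) := by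
    rw [ha₄, map_div₀, map_neg, map_div₀, Valuation.map_neg, map_ofNat φ 48, h48,
      div_one]
  have hwsa₆ : w (φ (Cs • W).a₆) = w (φ W.c₆) := by
    rw [ha₆, map_div₀, map_neg, map_div₀, Valuation.map_neg, map_ofNat φ 864, h864,
      div_one]
  have hwa₄ : w (u⁻¹ ^ 4 * φ (Cs • W).a₄) ≤ 1 := by
    rw [map_mul, map_pow, map_inv₀, hwsa₄]
    calc (w u)⁻¹ ^ 4 * w (φ W.c₄) ≤ (w u)⁻¹ ^ 4 * w u ^ 4 := mul_le_mul' le_rfl hc4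
      _ = 1 := by rw [← mul_pow, inv_mul_cancel₀ hwu0, one_pow]
  have hwa₆ : w (u⁻¹ ^ 6 * φ (Cs • W).a₆) ≤ 1 := by
    rw [map_mul, map_pow, map_inv₀, hwsa₆]
    calc (w u)⁻¹ ^ 6 * w (φ W.c₆) ≤ (w u)⁻¹ ^ 6 * w u ^ 6 := mul_le_mul' le_rfl hc6
      _ = 1 := by rw [← mul_pow, inv_mul_cancel₀ hwu0, one_pow]
  -- the model
  set Cu : VariableChange L := ⟨Units.mk0 u hu0, 0, 0, 0⟩ with hCu
  set C : VariableChange L := Cu * Cs.map φ with hC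
  set W₀ : WeierstrassCurve w.integer :=
    ⟨0, 0, 0, ⟨u⁻¹ ^ 4 * φ (Cs • W).a₄, hwa₄⟩, ⟨u⁻¹ ^ 6 * φ (Cs • W).a₆, hwa₆⟩⟩ with hW₀
  have hX : (W.baseChange (v.adicCompletion ℚ)).baseChange L = W.map φ := by
    rw [baseChange_baseChange_adicCompletion]; rfl
  have hCuu : ((Cu.u⁻¹ : Lˣ) : L) = u⁻¹ := by rw [hCu, Units.val_inv_eq_inv_val, Units.val_mk0]
  have hmodel : C • (W.baseChange (v.adicCompletion ℚ)).baseChange L = W₀.baseChange L := by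
    rw [hX, hC, mul_smul, map_variableChange]
    ext
    · simp [variableChange_a₁, hCu, hW₀]
    · simp [variableChange_a₂, hCu, hW₀]
    · simp [variableChange_a₃, hCu, hW₀]
    · rw [variableChange_a₄, hCuu]
      simp [hCu, hW₀]
      rfl
    · rw [variableChange_a₆, hCuu]
      simp [hCu, hW₀]
      rfl
  refine ⟨C, W₀, hmodel, ?_, ⟨hu0, Cs, rfl⟩, fun ψ hψu ↦ ?_⟩
  · -- unit discriminant: `Δ(W₀) = Δ/u^{12}`, `|u|^{12} = |Δ|`
    apply hvO.isUnit_of_one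
    · exact isUnit_iff_ne_zero.mpr (by
        intro h0
        have h : (W₀.baseChange L).Δ = 0 := by rw [baseChange, map_Δ]; exact h0
        rw [← hmodel, variableChange_Δ, hX, map_Δ] at h
        exact (mul_ne_zero (pow_ne_zero _ (Units.ne_zero _)) ((map_ne_zero φ).mpr W.isUnit_Δ.ne_zero)) h)
    · have hCval : ((C.u⁻¹ : Lˣ) : L) = u⁻¹ := by
        rw [Units.val_inv_eq_inv_val, hC, VariableChange.mul_def]
        simp [hCu, hCsu]
      have h : w (W₀.baseChange L).Δ = 1 := by
        rw [← hmodel, variableChange_Δ, hX, map_Δ, hCval, map_mul, map_pow, map_inv₀, ← hwu12, ← mul_pow,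
          inv_mul_cancel₀ hwu0, one_pow]
      rw [baseChange, map_Δ] at h
      exact h
  · -- any `ψ` fixing `u` fixes `C`: `r, s, t ∈ ℚ` always
    have hψφ : (ψ : L →+* L).comp φ = φ := Subsingleton.elim _ _
    have hCs' : (Cs.map φ).map (ψ : L →+* L) = Cs.map φ := by
      rw [VariableChange.map_map, hψφ]
    have hCu' : Cu.map (ψ : L →+* L) = Cu := by
      rw [hCu]
      ext
      · simp [VariableChange.map, hψu]
      · simp [VariableChange.map]
      · simp [VariableChange.map]
      · simp [VariableChange.map]
    rw [hC, show (Cu * Cs.map φ).map (ψ : L →+* L) = Cu.map (ψ : L →+* L) * (Cs.map φ).map (ψ : L →+* L)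
      from map_mul (VariableChange.mapHom (ψ : L →+* L)) Cu (Cs.map φ), hCu', hCs']


/-! ## §2 A GLOBAL Kummer generator: `θ ∈ ℚ̄`, `θ^e = p`, `u = ι(θ)^m` -/

/-- **THE KUMMER–DEURING MODEL WITH A GLOBAL GENERATOR.** `E/ℚ` globally minimal, `p ≥ 5`, `v ∋ p`,
`ord_p j(E) ≥ 0`, `e = semistabilityIndex W p`, `ι = absClosureEmbedding ℚ ℚ_v : ℚ̄ → K̄_v`. There
are `θ ∈ ℚ̄` with `θ^e = p`, a change of variables `C = ⟨ι(θ)^m, 0, 0, 0⟩ · Cs` (`Cs` over `ℚ`) and a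
model `W₀` over `𝒪_w` with `C • E ⊗ K̄_v = W₀ ⊗ K̄_v`, `Δ(W₀)` a unit, such that
(i) every `σ ∈ Γ_{ℚ_v}` with `σ • ι θ = ι θ` fixes `C` — the interface of p05's R-D identification
(T-RD-E346: the fixing group is `Gal(ℚ̄/ℚ(θ))` pulled back), and (ii) `σ^e` fixes `C` for every
local inertia element `σ` (Kummer, FILE A1 `pow_smul_eq_of_pow_eq_natCast_pow` at `m = 1`).
[cite: SilvermanAEC2009, Prop. VII.5.5] [cite: Serre1972, §5.6 (p. 312)] [cite: GreenbergLNM1716, §2 Prop. 2.4] -/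
theorem exists_kummerGoodModel_global (hp5 : 5 ≤ p) (hpv : ((p : ℕ) : 𝓞 ℚ) ∈ v.asIdeal)
    (hj : 0 ≤ padicValRat p W.j) :
    ∃ (θ : AlgebraicClosure ℚ) (C : VariableChange (AlgebraicClosure (v.adicCompletion ℚ)))
      (W₀ : WeierstrassCurve (specVal v).integer),
      θ ^ semistabilityIndex W p = ((p : ℕ) : AlgebraicClosure ℚ) ∧
      C • (W.baseChange (v.adicCompletion ℚ)).baseChange (AlgebraicClosure (v.adicCompletion ℚ)) =
        W₀.baseChange (AlgebraicClosure (v.adicCompletion ℚ)) ∧ IsUnit W₀.Δ ∧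
      (∃ (hu0 : absClosureEmbedding ℚ (v.adicCompletion ℚ) θ ^
            (padicValInt p W.minimalDiscriminantInt / Nat.gcd 12 (padicValInt p W.minimalDiscriminantInt)) ≠ 0)
          (Cs : VariableChange ℚ),
        C = ⟨Units.mk0 _ hu0, 0, 0, 0⟩ * Cs.map (algebraMap ℚ (AlgebraicClosure (v.adicCompletion ℚ)))) ∧
      (∀ σ : absoluteGaloisGroup (v.adicCompletion ℚ),
        σ • absClosureEmbedding ℚ (v.adicCompletion ℚ) θ = absClosureEmbedding ℚ (v.adicCompletion ℚ) θ →
        C.map ((absoluteGaloisGroup.toAlgEquiv _ σ :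
          AlgebraicClosure (v.adicCompletion ℚ) ≃ₐ[v.adicCompletion ℚ]
            AlgebraicClosure (v.adicCompletion ℚ)) :
          AlgebraicClosure (v.adicCompletion ℚ) →+* AlgebraicClosure (v.adicCompletion ℚ)) = C) ∧
      ∀ σ ∈ absInertia (v.adicCompletion ℚ),
        C.map ((absoluteGaloisGroup.toAlgEquiv _ (σ ^ semistabilityIndex W p) :
          AlgebraicClosure (v.adicCompletion ℚ) ≃ₐ[v.adicCompletion ℚ]
            AlgebraicClosure (v.adicCompletion ℚ)) :
          AlgebraicClosure (v.adicCompletion ℚ) →+* AlgebraicClosure (v.adicCompletion ℚ)) = C := by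
  set L := AlgebraicClosure (v.adicCompletion ℚ)
  set ι : AlgebraicClosure ℚ →ₐ[ℚ] L := absClosureEmbedding ℚ (v.adicCompletion ℚ) with hι
  set e : ℕ := semistabilityIndex W p with hedef
  set m : ℕ := padicValInt p W.minimalDiscriminantInt / Nat.gcd 12 (padicValInt p W.minimalDiscriminantInt)
    with hm
  have he0 : e ≠ 0 := semistabilityIndex_ne_zero p W
  have hpe : ¬ p ∣ e := not_dvd_semistabilityIndex p W hp5
  obtain ⟨θ, hθ⟩ := IsAlgClosed.exists_pow_nat_eq ((p : ℕ) : AlgebraicClosure ℚ) (Nat.pos_of_ne_zero he0)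
  have hιθ : ι θ ^ e = ((p : ℕ) : L) := by rw [← map_pow, hθ, map_natCast]
  have hu : (ι θ ^ m) ^ e = ((p : ℕ) : L) ^ m := by rw [← pow_mul, mul_comm, pow_mul, hιθ]
  obtain ⟨C, W₀, hW₀, hΔ, ⟨hu0, Cs, hC⟩, hfix⟩ := exists_goodModel_of_kummerElement p W hp5 hpv hj hu
  refine ⟨θ, C, W₀, hθ, hW₀, hΔ, ⟨hu0, Cs, hC⟩, fun σ hσ ↦ hfix _ ?_, fun σ hσ ↦ hfix _ ?_⟩
  · -- `σ` fixes `ι θ`, hence `u = ι(θ)^m`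
    have h1 : absoluteGaloisGroup.toAlgEquiv _ σ (ι θ) = ι θ := hσ
    rw [map_pow, h1]
  · -- Kummer: `σ^e` fixes `ι θ` (`(ι θ)^e = p`), hence `u`
    have h1 : absoluteGaloisGroup.toAlgEquiv _ (σ ^ e) (ι θ) = ι θ :=
      pow_smul_eq_of_pow_eq_natCast_pow p hpv he0 hpe (m := 1) (by rw [pow_one]; exact hιθ) hσ
    rw [map_pow, h1]

end Local

end Summit.BirchSwinnertonDyer.Rank1Residual.Additive.GoodModelLine

end
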